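import Summits.Ventures.PercRepro.S1DisjointSumRank

/-!
# PercRepro — A COLOOP-FREE MATROID OF NULLITY ONE IS A CIRCUIT (p2, gen 28; SUBCLAIM-S1 §6.10 (xvii)(i))

If `|E| = ρ(E) + 1` and `M` has no coloop, then `E` itself is a circuit: `E` is dependent, so it contains a
circuit `C`; an element `x ∉ C` would have `E ∖ {x} ⊇ C` dependent, hence `ρ(E ∖ {x}) < |E ∖ {x}| = ρ(E)`, hence
`x` a coloop. This is what turns «a part of corank `1`» of a `1`-separation of a core into «a circuit summand»,
the case the consumers close. Nothing is claimed about any cell.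

* **`isCircuit_ground_of_ncard_eq_eRank_add_one`**.
Axioms: standard.
-/

open scoped Matroid

namespace PercRepro

namespace S1

open Set

variable {α : Type}

/-- **A coloop-free matroid of nullity one has a circuit for its ground set**: `|E| = r + 1`, `ρ(E) = r` and
`coloops = ∅` give `M.IsCircuit M.E`. -/
theorem isCircuit_ground_of_ncard_eq_eRank_add_one (M : Matroid α) [M.Finite] {r : ℕ} (hr : M.eRank = r)
    (hE : M.E.ncard = r + 1) (hcol : M.coloops = ∅) : M.IsCircuit M.E := by
  -- `E` is dependent: its rank `r` is below its cardinality `r + 1`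
  have hdep : M.Dep M.E := by
    refine ⟨fun hind => ?_, subset_rfl⟩
    have h := hind.eRk_eq_encard
    rw [M.eRk_ground, hr, ← M.ground_finite.cast_ncard_eq, hE] at h
    have h' : r = r + 1 := by exact_mod_cast h
    omega
  obtain ⟨C, hCE, hC⟩ := hdep.exists_isCircuit_subset
  -- every element lies in `C`
  have hEC : M.E ⊆ C := by
    intro x hx
    by_contra hxC
    -- `E ∖ {x}` contains `C`, hence is dependent, hence has rank `< |E ∖ {x}| = r`
    have hCsub : C ⊆ M.E \ {x} := fun y hy => ⟨hCE hy, fun hyx => hxC (by rw [mem_singleton_iff] at hyx; rw [← hyx]; exact hy)⟩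
    have hdep' : ¬ M.Indep (M.E \ {x}) := fun hind => hC.not_indep (hind.subset hCsub)
    have hfin : (M.E \ {x}).Finite := M.ground_finite.subset sdiff_subset
    have hcard : (M.E \ {x}).ncard = r := by
      rw [ncard_sdiff_singleton_of_mem hx, hE]
      rfl
    have hlt : M.eRk (M.E \ {x}) ≠ (r : ℕ∞) := by
      intro heq
      apply hdep'
      rw [Matroid.indep_iff_eRk_eq_encard_of_finite hfin, heq, ← hfin.cast_ncard_eq, hcard]
    -- so `x` is a coloop
    have hcolx : M.IsColoop x := by
      rw [Matroid.isColoop_iff_notMem_closure_compl hx, mem_closure_iff_eRk_insert_eq M hx sdiff_subset,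
        insert_sdiff_self_of_mem hx, M.eRk_ground, hr]
      intro heq
      exact hlt heq.symm
    have hmem : x ∈ M.coloops := hcolx
    rw [hcol] at hmem
    exact hmem
  have hEq : C = M.E := hCE.antisymm hEC
  rw [← hEq]
  exact hC

end S1

end PercRepro
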